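import Literature.NumberTheory.Automorphic.CompletedCohomologyAction
import Literature.NumberTheory.Automorphic.CompletedCohomologyGLHecke
import Literature.NumberTheory.Automorphic.GLnCuspidalSpectrumProofs
import HarnessLib

/-!
# The action of `GL_n(K_v)`, `v ∣ p`, on the completed cohomology of `GL_n`

Topic `NumberTheory/Automorphic`, namespaces `Literature.NumberTheory.Automorphic.ArithmeticQuotient`
(generic part) and `Literature.NumberTheory.Automorphic.BigHeckeGLn.TameLevel` (`GL_n` part); continues
`CompletedCohomologyAction` (right translations `translateHom`, the normaliser `T.normalizer` of a
tower and its representation `CompletedCohomology.rep` on `H̃^i`) and `CompletedCohomologyGLHecke`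
(the `p`-power tower `𝒰.levelTower` of an `S`-good tame level `𝒰 : TameLevel n K p` of `GL_n` over a
number field `K`, and the Hecke operators `completedHeckeT` of the good places on `H̃^•`).

* (generic) `ArithmeticQuotient.heckeFun_comp_translateQuot`,
  `heckeOperator_comp_cohomologyTranslate`: the double-coset operator `[L g₀ L]` and the right
  translation by `g` commute as soon as `c ↦ g⁻¹ c g` maps `L' g₀ L' / L'` bijectively onto
  `L g₀ L / L`, with the group-theoretic criterion `bijOn_doubleCosetQuot_conj` (for `g` commuting
  with `g₀`); consequently `completedHecke_rep`: on `H̃^i` the Hecke operator of a tower-compatible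
  `g₀` commutes with `ρ(g)` for `g ∈ T.normalizer` satisfying the criterion along the tower;
* (`GL_n`) `TameLevel.isContinuousAt_ofLocal`: for a place `v` above `p`, every
  `g ∈ GL_n(K_v)` (embedded at `v` by `ofLocal`) is continuous at the tower `U_r` — every `U_r`
  contains `g⁻¹ U_{r'} g` for `r'` large —, proved topologically: `U_r` is open and the principal
  congruence subgroups are a neighbourhood basis of `1` in `GL_n(K_v)`
  (`exists_localCongruenceSubgroup_subset`); hence `TameLevel.toNormalizer v : GL_n(K_v) →*
  𝒰.levelTower.normalizer` and **`TameLevel.completedCohomologyLocalRep 𝒰 v k i :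
  Representation k (GL_n(K_v)) (H̃^i(K^p)_k)`**, the action of the `p`-adic group `GL_n(K_v)` on
  Emerton's completed cohomology of tame level `𝒰` [Emerton2006, §2.2, Lemma 2.2.10 and
  Thm. 2.2.11 (i)] (`G = G(F_𝔭)`), [CalegariEmerton2011, §1.5], by continuous maps
  (`continuous_completedCohomologyLocalRep`);
* (`GL_n`) `TameLevel.completedHeckeT_completedCohomologyLocalRep`: this action commutes with the
  Hecke operators `T_{w,i}` of the good places `w ∉ S` (the criterion is verified in
  `bijOn_tower_heckeElement_conj`: `g` at `v ∣ p` and `t_{w,i}` at `w ∤ p` have disjoint supports);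
* (`GL_n`) `TameLevel.subgroup_le_normalizer`: the tame level `U` itself (so Emerton's compact open
  `G₀ = U_p` and the `U_r`) normalises the tower (`GL_m(𝒪)` normalises the principal
  congruence subgroups), hence also acts.

NOT here: continuity of the action map `GL_n(K_v) × H̃^i → H̃^i` jointly / local analyticity,
admissibility [Emerton2006, Thm. 2.2.11 (i)], the simultaneous action of `∏_{v ∣ p} GL_n(K_v)`
(obtained from `toNormalizer` at each `v`, the images commuting), and the action of the centre /
component groups.

## References

* M. Emerton, Invent. Math. 164 (2006), §2.2, Lemma 2.2.10, Thm. 2.2.11 [Emerton2006].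
* F. Calegari, M. Emerton, *Completed cohomology — a survey* (2012), §1.5 [CalegariEmerton2011].
-/

noncomputable section

open CategoryTheory Topology
open scoped NumberField

universe u

namespace Literature.NumberTheory.Automorphic

/-! ### Hecke operators commute with right translations (generic criterion) -/

namespace ArithmeticQuotient

section HeckeTranslate

variable (k : Type u) [CommRing k] {Γ 𝒢 : Type u} [Group Γ] [Group 𝒢]
variable (ι : Γ →* 𝒢) {L L' : Subgroup 𝒢} (M : Type u) [AddCommGroup M] [Module k M]

omit [Group Γ] in
variable {k M} in
/-- If `c ↦ g⁻¹ (c g)` maps `L' g₀ L' / L'` bijectively onto `L g₀ L / L` (finite), the double-coset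
operators `[L' g₀ L']`, `[L g₀ L]` commute with right translation by `g` on functions:
`T^{L'}_{g₀} (f ∘ τ_g) = (T^{L}_{g₀} f) ∘ τ_g`. [cite: ShimuraIATAF1971, Ch. 3, Prop. 3.1] -/
theorem heckeFun_comp_translateQuot {g g₀ : 𝒢} (h : ConjInto g L' L)
    (hbij : Set.BijOn (fun c => g⁻¹ • translateQuot g h c) (doubleCosetQuot L' g₀) (doubleCosetQuot L g₀))
    (hfin : (doubleCosetQuot L g₀).Finite) (f : (𝒢 ⧸ L) → M) :
    heckeFun k L' g₀ M (f ∘ translateQuot g h) = heckeFun k L g₀ M f ∘ translateQuot g h := by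
  have hfin' : (doubleCosetQuot L' g₀).Finite :=
    Set.Finite.of_finite_image (hbij.image_eq.symm ▸ hfin) hbij.injOn
  funext c
  induction c using QuotientGroup.induction_on with
  | H x =>
    rw [Function.comp_apply, heckeFun_apply_coe k L' M g₀ _ x hfin', translateQuot_mk,
      heckeFun_apply_coe k L M g₀ f (x * g) hfin]
    simp only [Function.comp_apply, translateQuot_smul]
    refine Finset.sum_nbij (fun c => g⁻¹ • translateQuot g h c) (fun d hd => ?_) ?_ ?_ fun d _ => ?_
    · rw [Set.Finite.mem_toFinset] at hd ⊢
      exact hbij.mapsTo hd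
    · rw [Set.Finite.coe_toFinset]
      exact hbij.injOn
    · rw [Set.Finite.coe_toFinset, Set.Finite.coe_toFinset]
      exact hbij.surjOn
    · rw [smul_smul, mul_assoc, mul_inv_cancel, mul_one]

omit [Group Γ] in
/-- **Group-theoretic criterion** for the bijection `L' g₀ L' / L' → L g₀ L / L`, `c ↦ g⁻¹ c g`, for
`g` commuting with `g₀` and `g⁻¹ L' g ⊆ L`: it suffices that (a) every `l ∈ L` factors as
`l = l' · g₀ m g₀⁻¹` with `l' ∈ L'` commuting with `g` and `m ∈ L`, and (b) for `y ∈ L'`,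
`g₀⁻¹ (g⁻¹ y g) g₀ ∈ L` implies `g₀⁻¹ y g₀ ∈ L'`.  For the tower `Kᵖ K_p(p^s)`, `g ∈ G(ℚ_p)` and
`g₀` supported away from `p` both hold with `l' =` the component of `l` at the support of `g₀`
(`BigHeckeGLn.TameLevel.bijOn_tower_heckeElement_conj`). [cite: ShimuraIATAF1971, Ch. 3, Prop. 3.1] -/
theorem bijOn_doubleCosetQuot_conj {g : 𝒢} (h : ConjInto g L' L) (g₀ : 𝒢) (hc : Commute g₀ g)
    (ha : ∀ l ∈ L, ∃ l' ∈ L', Commute l' g ∧ ∃ m ∈ L, l = l' * (g₀ * m * g₀⁻¹))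
    (hb : ∀ y ∈ L', g₀⁻¹ * (g⁻¹ * y * g) * g₀ ∈ L → g₀⁻¹ * y * g₀ ∈ L') :
    Set.BijOn (fun c => g⁻¹ • translateQuot g h c) (doubleCosetQuot L' g₀) (doubleCosetQuot L g₀) := by
  -- the map on the orbit: `l' g₀ L' ↦ (g⁻¹ l' g) g₀ L`
  have key : ∀ l' : 𝒢, g⁻¹ • translateQuot g h ((l' : 𝒢) • (g₀ : 𝒢 ⧸ L')) =
      ((g⁻¹ * l' * g * g₀ : 𝒢) : 𝒢 ⧸ L) := by
    intro l'
    rw [MulAction.Quotient.smul_coe, smul_eq_mul, translateQuot_mk, MulAction.Quotient.smul_coe,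
      smul_eq_mul, mul_assoc l' g₀ g, hc.eq, ← mul_assoc, ← mul_assoc]
  refine ⟨?_, ?_, ?_⟩
  · rintro _ ⟨l', rfl⟩
    refine ⟨⟨g⁻¹ * l' * g, h _ l'.2⟩, ?_⟩
    change ((g⁻¹ * l' * g : 𝒢) • (g₀ : 𝒢 ⧸ L)) = g⁻¹ • translateQuot g h ((l' : 𝒢) • (g₀ : 𝒢 ⧸ L'))
    rw [key, MulAction.Quotient.smul_coe, smul_eq_mul]
  · rintro _ ⟨l₁, rfl⟩ _ ⟨l₂, rfl⟩ he
    change g⁻¹ • translateQuot g h ((l₁ : 𝒢) • (g₀ : 𝒢 ⧸ L')) =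
      g⁻¹ • translateQuot g h ((l₂ : 𝒢) • (g₀ : 𝒢 ⧸ L')) at he
    rw [key, key, QuotientGroup.eq] at he
    change ((l₁ : 𝒢) • (g₀ : 𝒢 ⧸ L')) = (l₂ : 𝒢) • (g₀ : 𝒢 ⧸ L')
    rw [MulAction.Quotient.smul_coe, MulAction.Quotient.smul_coe, smul_eq_mul, smul_eq_mul,
      QuotientGroup.eq]
    have he' : g₀⁻¹ * (g⁻¹ * ((l₁ : 𝒢)⁻¹ * l₂) * g) * g₀ ∈ L := by
      convert he using 1
      group
    have := hb _ (L'.mul_mem (L'.inv_mem l₁.2) l₂.2) he'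
    convert this using 1
    group
  · rintro _ ⟨l, rfl⟩
    obtain ⟨l', hl', hcomm, m, hm, hl⟩ := ha l l.2
    refine ⟨(⟨l', hl'⟩ : L') • (g₀ : 𝒢 ⧸ L'), ⟨⟨l', hl'⟩, rfl⟩, ?_⟩
    change g⁻¹ • translateQuot g h ((l' : 𝒢) • (g₀ : 𝒢 ⧸ L')) = ((l : 𝒢) * g₀ : 𝒢 ⧸ L)
    have e : g⁻¹ * l' * g = l' := by rw [mul_assoc, hcomm.eq, inv_mul_cancel_left]
    rw [key, QuotientGroup.eq, e, hl]
    convert hm using 1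
    group

/-- Under the bijectivity hypothesis of `heckeFun_comp_translateQuot`, the Hecke operators on the
coefficient representations commute with right translation. [folklore] -/
theorem heckeRepHom_comp_translateHom {g g₀ : 𝒢} (h : ConjInto g L' L)
    (hbij : Set.BijOn (fun c => g⁻¹ • translateQuot g h c) (doubleCosetQuot L' g₀) (doubleCosetQuot L g₀))
    (hfin : (doubleCosetQuot L g₀).Finite) :
    heckeRepHom k L g₀ M ι ≫ translateHom k ι M g h = translateHom k ι M g h ≫ heckeRepHom k L' g₀ M ι :=
  Rep.hom_ext (Representation.IntertwiningMap.ext (LinearMap.ext fun f =>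
    (heckeFun_comp_translateQuot (k := k) h hbij hfin f).symm))

/-- **Hecke operators commute with right translation in cohomology** when `c ↦ g⁻¹ c g` is a
bijection `L' g₀ L' / L' → L g₀ L / L` (e.g. levels of the tower `Kᵖ K_p(p^s)`, `g ∈ G(ℚ_p)` and
`g₀` a Hecke element away from `p`). [cite: Emerton2006, §2.2, Thm. 2.2.16 (i)] -/
theorem heckeOperator_comp_cohomologyTranslate {g g₀ : 𝒢} (h : ConjInto g L' L)
    (hbij : Set.BijOn (fun c => g⁻¹ • translateQuot g h c) (doubleCosetQuot L' g₀) (doubleCosetQuot L g₀))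
    (hfin : (doubleCosetQuot L g₀).Finite) (i : ℕ) :
    heckeOperator k L g₀ M ι i ≫ cohomologyTranslate k ι M g h i =
      cohomologyTranslate k ι M g h i ≫ heckeOperator k L' g₀ M ι i := by
  rw [heckeOperator, cohomologyTranslate, ← groupCohomology.map_id_comp,
    heckeRepHom_comp_translateHom k ι M h hbij hfin, groupCohomology.map_id_comp]

end HeckeTranslate

end ArithmeticQuotient

/-! ### Consequence for towers: Hecke operators commute with the action of the normaliser -/

section TowerHecke

variable {k : Type u} [CommRing k] {Γ 𝒢 : Type u} [Group Γ] [Group 𝒢]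
variable {ι : Γ →* 𝒢} {T : LevelTower 𝒢} {ϖ : k}

/-- `IsHeckeCompatibleWith T g₀ g`: along the tower, `c ↦ g⁻¹ c g` maps `K(s') g₀ K(s') / K(s')`
bijectively onto `K(s) g₀ K(s) / K(s)` whenever `g⁻¹ K(s') g ⊆ K(s)`, and these double cosets are
finite — the hypothesis under which `ρ(g)` commutes with the Hecke operator of `g₀` on `H̃^•`.
[folklore] -/
def IsHeckeCompatibleWith (T : LevelTower 𝒢) (g₀ g : 𝒢) : Prop :=
  (∀ {s s' : ℕ} (h : ArithmeticQuotient.ConjInto g (T.level s') (T.level s)),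
    Set.BijOn (fun c => g⁻¹ • ArithmeticQuotient.translateQuot g h c)
      (ArithmeticQuotient.doubleCosetQuot (T.level s') g₀)
      (ArithmeticQuotient.doubleCosetQuot (T.level s) g₀)) ∧
  ∀ s : ℕ, (ArithmeticQuotient.doubleCosetQuot (T.level s) g₀).Finite

/-- On `H̃^i(k/ϖ^t)`, the Hecke operator of a tower-compatible `g₀` commutes with `ρ(g)` for
`g ∈ T.normalizer` Hecke-compatible with `g₀`. [cite: Emerton2006, §2.2, Thm. 2.2.16 (i)] -/
theorem completedHeckeMod_rep {g₀ : 𝒢} (hg₀ : IsTowerCompatible k ι T ϖ g₀) (g : T.normalizer)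
    (hg : IsHeckeCompatibleWith T g₀ (g : 𝒢)) (i t : ℕ) (x : completedCohomologyMod k ι T ϖ i t) :
    completedHeckeMod hg₀ i t (completedCohomologyModRep k ι T ϖ i t g x) =
      completedCohomologyModRep k ι T ϖ i t g (completedHeckeMod hg₀ i t x) := by
  induction x using Module.DirectLimit.induction_on with
  | ih s c =>
    obtain ⟨s', h⟩ := g.2.1 s
    change completedHeckeMod hg₀ i t
        (completedCohomologyModRep k ι T ϖ i t g (toCompletedCohomologyMod k ι T ϖ i s t c)) =
      completedCohomologyModRep k ι T ϖ i t g
        (completedHeckeMod hg₀ i t (toCompletedCohomologyMod k ι T ϖ i s t c))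
    rw [completedCohomologyModRep_apply_of k ι T ϖ i t g h, completedHeckeMod_of, completedHeckeMod_of,
      completedCohomologyModRep_apply_of k ι T ϖ i t g h]
    change toCompletedCohomologyMod k ι T ϖ i s' t ((towerTranslate k ι T ϖ i t (g : 𝒢) h ≫
        ArithmeticQuotient.heckeOperator k (T.level s') g₀ (modPow k ϖ t) ι i).hom c) =
      toCompletedCohomologyMod k ι T ϖ i s' t ((ArithmeticQuotient.heckeOperator k (T.level s) g₀
        (modPow k ϖ t) ι i ≫ towerTranslate k ι T ϖ i t (g : 𝒢) h).hom c)
    rw [towerTranslate, ArithmeticQuotient.heckeOperator_comp_cohomologyTranslate k ι (modPow k ϖ t) h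
      (hg.1 h) (hg.2 s) i]

/-- **On `H̃^i`, the Hecke operator of `g₀` commutes with `ρ(g)`** (`g₀` tower-compatible,
`g ∈ T.normalizer` Hecke-compatible with `g₀`): the actions of the `p`-adic group and of the
prime-to-`p` Hecke algebra on completed cohomology commute [Emerton2006, §2.2, Thm. 2.2.16 (i)]
(`π₀ × G(𝔸_f)`-action, of which `G(F_𝔭) × ℋ(K^p)` is the part formalised here).
[cite: Emerton2006, §2.2, Thm. 2.2.16 (i)] -/
theorem completedHecke_rep {g₀ : 𝒢} (hg₀ : IsTowerCompatible k ι T ϖ g₀) (g : T.normalizer)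
    (hg : IsHeckeCompatibleWith T g₀ (g : 𝒢)) (i : ℕ) (x : CompletedCohomology k ι T ϖ i) :
    completedHecke hg₀ i (CompletedCohomology.rep k ι T ϖ i g x) =
      CompletedCohomology.rep k ι T ϖ i g (completedHecke hg₀ i x) :=
  Subtype.ext (funext fun t => completedHeckeMod_rep hg₀ g hg i t (x.1 t))

end TowerHecke

/-! ### Conjugation by integral matrices preserves the congruence subgroups -/

section Valued

variable {F Γ₀ : Type*} [Field F] [LinearOrderedCommGroupWithZero Γ₀] [Valued F Γ₀]
  {m : Type*} [Fintype m] [DecidableEq m]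

/-- **`GL_m(𝒪)` normalises the congruence subgroups**: for `u` integral with integral inverse
(`u ∈ valuedCongruenceSubgroup m 1`) and `x ≡ 1 (mod {v ≤ c})`, also `u⁻¹ x u ≡ 1 (mod {v ≤ c})`
(`u⁻¹ x u - 1 = u⁻¹ (x - 1) u` and the ultrametric bound `valued_mul_apply_le`;
Bushnell–Henniart §1.1: the `K_v(𝔭^r)` are normal in `GL_m(𝒪_v)`).  A `private` copy (general index
type `m`) of `inv_mul_mul_mem_valuedCongruenceSubgroup` of `WhittakerSupportFinite`, which is not
imported here so as to keep the Whittaker / cusp-form analysis out of the import closure of completed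
cohomology. [folklore] -/
private theorem conj_mem_valuedCongruenceSubgroup_aux {c : Γ₀} {u x : GL m F}
    (hu : u ∈ valuedCongruenceSubgroup m (1 : Γ₀)) (hx : x ∈ valuedCongruenceSubgroup m c) :
    u⁻¹ * x * u ∈ valuedCongruenceSubgroup m c := by
  obtain ⟨hu₁, hu₂, -⟩ := hu
  obtain ⟨hx₁, hx₂, hx₃⟩ := hx
  refine ⟨fun i j => ?_, fun i j => ?_, fun i j => ?_⟩
  · have := valued_mul_apply_le m (valued_mul_apply_le m hu₂ hx₁) hu₁ i j
    simpa only [Units.val_mul, one_mul] using this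
  · have := valued_mul_apply_le m (valued_mul_apply_le m hu₂ hx₂) hu₁ i j
    simpa only [mul_inv_rev, inv_inv, Units.val_mul, one_mul, Matrix.mul_assoc] using this
  · have hmat : ((u⁻¹ * x * u : GL m F) : Matrix m m F) - 1 =
        ((u⁻¹ : GL m F) : Matrix m m F) * ((x : Matrix m m F) - 1) * (u : Matrix m m F) := by
      rw [Matrix.mul_sub, Matrix.sub_mul, Matrix.mul_one, Units.inv_mul, Units.val_mul, Units.val_mul]
    rw [hmat]
    have := valued_mul_apply_le m (valued_mul_apply_le m hu₂ hx₃) hu₁ i j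
    simpa only [one_mul, mul_one] using this

end Valued

/-! ### `GL_n(K_v)`, `v ∣ p`, acts on the completed cohomology of `GL_n` -/

namespace BigHeckeGLn

variable {n : ℕ} {K : Type} [Field K] [NumberField K]

/-- The local embedding `ofLocal v : GL_n(K_v) →* GL_n(𝔸_K^∞)` is continuous (`GLn.continuous_toAdelic`
composed with the continuous projection to the finite adeles). [folklore] -/
theorem continuous_ofLocal (v : IsDedekindDomain.HeightOneSpectrum (𝓞 K)) : Continuous (ofLocal n K v) :=
  (continuous_snd.generalLinearGroup_map).comp (GLn.continuous_toAdelic n K v)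

/-- **Conjugation by a local element**: for `g ∈ GL_n(K_v)` and `u ∈ GL_n(𝔸_K^∞)`,
`ι_v(g)⁻¹ u ι_v(g) = u · ι_v(u_v⁻¹ g⁻¹ u_v g)` (the components away from `v` are unchanged).
[folklore] -/
theorem ofLocal_inv_mul_mul_ofLocal (v : IsDedekindDomain.HeightOneSpectrum (𝓞 K))
    (g : GL (Fin n) (v.adicCompletion K)) (u : FiniteAdelicGL n K) :
    (ofLocal n K v g)⁻¹ * u * ofLocal n K v g =
      u * ofLocal n K v ((localComponent n K v u)⁻¹ * g⁻¹ * localComponent n K v u * g) := by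
  refine ext_localComponent fun w => ?_
  by_cases hw : w = v
  · subst hw
    simp only [map_mul, map_inv, localComponent_ofLocal]
    group
  · simp only [map_mul, map_inv, localComponent_ofLocal_of_ne hw, inv_one, one_mul, mul_one]

namespace TameLevel

variable {p : ℕ} [Fact p.Prime] (𝒰 : TameLevel n K p)

/-- **Every `g ∈ GL_n(K_v)`, `v ∣ p`, is continuous at the `p`-power tower**: each `U_r` contains
`ι_v(g)⁻¹ U_{r'} ι_v(g)` for `r'` large.  Proof: `x ↦ ι_v(x⁻¹ g⁻¹ x g)` is continuous
`GL_n(K_v) → GL_n(𝔸_K^∞)` with value `1` at `1`, `U_r` is open, and the principal congruence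
subgroups `K_v(ϖ_v^m)` form a neighbourhood basis of `1` (`exists_localCongruenceSubgroup_subset`);
for `u ∈ U_{max r m}` one has `u_v ∈ K_v(ϖ_v^m)`, so `ι_v(g)⁻¹ u ι_v(g) = u · ι_v(u_v⁻¹ g⁻¹ u_v g) ∈ U_r`.
This is the cofinality underlying the `G(F_𝔭)`-action of [Emerton2006, §2.2, Lemma 2.2.10].
[cite: Emerton2006, §2.2, Lemma 2.2.10] -/
theorem isContinuousAt_ofLocal {v : IsDedekindDomain.HeightOneSpectrum (𝓞 K)}
    (hv : (p : 𝓞 K) ∈ v.asIdeal) (g : GL (Fin n) (v.adicCompletion K)) :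
    𝒰.levelTower.IsContinuousAt (ofLocal n K v g) := by
  intro r
  set φ : GL (Fin n) (v.adicCompletion K) → FiniteAdelicGL n K :=
    fun x => ofLocal n K v (x⁻¹ * g⁻¹ * x * g) with hφ
  have hφc : Continuous φ :=
    (continuous_ofLocal v).comp (((continuous_inv.mul continuous_const).mul continuous_id).mul
      continuous_const)
  have hφ1 : φ 1 = 1 := by simp [hφ]
  have hmem : φ ⁻¹' (𝒰.tower r : Set (FiniteAdelicGL n K)) ∈ 𝓝 (1 : GL (Fin n) (v.adicCompletion K)) :=
    hφc.continuousAt.preimage_mem_nhds (by rw [hφ1]; exact (𝒰.isOpen_tower r).mem_nhds (one_mem _))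
  obtain ⟨m, hm⟩ := exists_localCongruenceSubgroup_subset n K v hmem
  refine ⟨max r m, fun u hu => ?_⟩
  rw [levelTower_level] at hu ⊢
  have hur : u ∈ 𝒰.tower r := 𝒰.tower_antitone (le_max_left r m) hu
  have huv : localComponent n K v u ∈ localCongruenceSubgroup n K v m :=
    localCongruenceSubgroup_antitone n K v (le_max_right r m) (((𝒰.mem_tower_iff _ u).1 hu).2 v hv)
  rw [ofLocal_inv_mul_mul_ofLocal]
  exact mul_mem hur (hm huv)

/-- `ι_v(GL_n(K_v))`, `v ∣ p`, lies in the normaliser of the `p`-power tower. [folklore] -/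
theorem ofLocal_mem_normalizer {v : IsDedekindDomain.HeightOneSpectrum (𝓞 K)}
    (hv : (p : 𝓞 K) ∈ v.asIdeal) (g : GL (Fin n) (v.adicCompletion K)) :
    ofLocal n K v g ∈ 𝒰.levelTower.normalizer :=
  ⟨𝒰.isContinuousAt_ofLocal hv g, by rw [← map_inv]; exact 𝒰.isContinuousAt_ofLocal hv g⁻¹⟩

/-- **The tame level `U` normalises its `p`-power tower**: every `u ∈ U` is continuous at the
tower, indeed `u⁻¹ U_r u = U_r` (`U ≤ GL_n(𝒪̂_K)` and `GL_n(𝒪_w)` normalises `K_w(ϖ_w^r)`, cf.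
`inv_mul_mul_mem_valuedCongruenceSubgroup` of `WhittakerSupportFinite`); so `U` — in particular
Emerton's `G₀ = U_p` and the deep levels — lies in the normaliser and acts on `H̃^•` (the
`G₀`-action of [CalegariEmerton2011, §1.1]). [cite: CalegariEmerton2011, §1.1] -/
theorem subgroup_le_normalizer : 𝒰.subgroup ≤ 𝒰.levelTower.normalizer := by
  refine LevelTower.le_normalizer_of_forall fun u hu r => ⟨r, fun x hx => ?_⟩
  rw [levelTower_level, mem_tower_iff] at hx ⊢
  refine ⟨𝒰.subgroup.mul_mem (𝒰.subgroup.mul_mem (𝒰.subgroup.inv_mem hu) hx.1) hu, fun w hw => ?_⟩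
  rw [map_mul, map_mul, map_inv]
  exact conj_mem_valuedCongruenceSubgroup_aux
    (localComponent_mem_valuedCongruenceSubgroup_one (𝒰.le_glFiniteIntegralLevel hu) w) (hx.2 w hw)

/-- The homomorphism `GL_n(K_v) →* (normaliser of the tower)`, `v ∣ p`. [folklore] -/
def toNormalizer {v : IsDedekindDomain.HeightOneSpectrum (𝓞 K)} (hv : (p : 𝓞 K) ∈ v.asIdeal) :
    GL (Fin n) (v.adicCompletion K) →* 𝒰.levelTower.normalizer :=
  (ofLocal n K v).codRestrict _ fun g => 𝒰.ofLocal_mem_normalizer hv g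

/-- `toNormalizer` is `ofLocal` (on the underlying elements). [folklore] -/
@[simp]
theorem coe_toNormalizer {v : IsDedekindDomain.HeightOneSpectrum (𝓞 K)} (hv : (p : 𝓞 K) ∈ v.asIdeal)
    (g : GL (Fin n) (v.adicCompletion K)) :
    ((𝒰.toNormalizer hv g : 𝒰.levelTower.normalizer) : FiniteAdelicGL n K) = ofLocal n K v g :=
  rfl

variable (k : Type) [CommRing k]

/-- **The representation of `GL_n(K_v)`, `v ∣ p`, on Emerton's completed cohomology
`H̃^i(K^p)_k = CompletedCohomology k (globalEmbedding n K) 𝒰.levelTower p i` of `GL_n / K` of tame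
level `𝒰`**: `g • [c] = [translate_{ι_v(g)} c]` (`CompletedCohomology.rep` through `toNormalizer`) —
the action of `G = G(F_𝔭)` on `H̃^n(K^p, 𝒱)` of [Emerton2006, §2.2, Lemma 2.2.10, Thm. 2.2.11 (i)]
for `G = GL_n`, trivial `𝒱`; [CalegariEmerton2011, §1.5].  (Continuity of each `g`:
`continuous_completedCohomologyLocalRep`; admissibility is not formalised.)
[cite: Emerton2006, §2.2, Thm. 2.2.11 (i)] -/
def completedCohomologyLocalRep {v : IsDedekindDomain.HeightOneSpectrum (𝓞 K)}
    (hv : (p : 𝓞 K) ∈ v.asIdeal) (i : ℕ) :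
    Representation k (GL (Fin n) (v.adicCompletion K))
      (CompletedCohomology k (globalEmbedding n K) 𝒰.levelTower (p : k) i) :=
  (CompletedCohomology.rep k (globalEmbedding n K) 𝒰.levelTower (p : k) i).comp (𝒰.toNormalizer hv)

/-- Unfolding: `completedCohomologyLocalRep g = CompletedCohomology.rep (toNormalizer g)`.
[folklore] -/
theorem completedCohomologyLocalRep_apply {v : IsDedekindDomain.HeightOneSpectrum (𝓞 K)}
    (hv : (p : 𝓞 K) ∈ v.asIdeal) (i : ℕ) (g : GL (Fin n) (v.adicCompletion K)) :
    𝒰.completedCohomologyLocalRep k hv i g =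
      CompletedCohomology.rep k (globalEmbedding n K) 𝒰.levelTower (p : k) i (𝒰.toNormalizer hv g) :=
  rfl

/-- Each `g ∈ GL_n(K_v)` acts on `H̃^i(K^p)_k` by a continuous map (inverse-limit topology).
[cite: Emerton2006, §2.2, Lemma 2.2.10] -/
theorem continuous_completedCohomologyLocalRep {v : IsDedekindDomain.HeightOneSpectrum (𝓞 K)}
    (hv : (p : 𝓞 K) ∈ v.asIdeal) (i : ℕ) (g : GL (Fin n) (v.adicCompletion K)) :
    Continuous (𝒰.completedCohomologyLocalRep k hv i g) :=
  CompletedCohomology.continuous_rep k (globalEmbedding n K) 𝒰.levelTower (p : k) i _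

/-! ### The action commutes with the Hecke operators at the good places -/

variable {𝒰 k}

/-- **The criterion `bijOn_doubleCosetQuot_conj` for the `p`-power tower**: for `v ∣ p`,
`g ∈ GL_n(K_v)`, a good place `w ∉ S` and `ι_v(g)⁻¹ U_{r'} ι_v(g) ⊆ U_r`, conjugation by `ι_v(g)`
maps `U_{r'} t U_{r'} / U_{r'}` bijectively onto `U_r t U_r / U_r`, `t = t_{w,i}`: both are
parametrised by the `w`-components of elements of `U` (factorizability of `U` at `w`), on which
conjugation by `ι_v(g)` is the identity. [folklore] -/
theorem bijOn_tower_heckeElement_conj {v : IsDedekindDomain.HeightOneSpectrum (𝓞 K)}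
    (hv : (p : 𝓞 K) ∈ v.asIdeal) (g : GL (Fin n) (v.adicCompletion K))
    {w : IsDedekindDomain.HeightOneSpectrum (𝓞 K)} (hw : w ∉ 𝒰.bad) (i : ℕ) {r r' : ℕ}
    (h : ArithmeticQuotient.ConjInto (ofLocal n K v g) (𝒰.tower r') (𝒰.tower r)) :
    Set.BijOn (fun c => (ofLocal n K v g)⁻¹ • ArithmeticQuotient.translateQuot (ofLocal n K v g) h c)
      (ArithmeticQuotient.doubleCosetQuot (𝒰.tower r') (heckeElement n K w i))
      (ArithmeticQuotient.doubleCosetQuot (𝒰.tower r) (heckeElement n K w i)) := by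
  have hwv : w ≠ v := fun h' => not_mem_asIdeal_of_not_mem_bad hw (h' ▸ hv)
  set t := heckeElement n K w i with htdef
  -- `t` is supported at `w`, `ι_v(g)` at `v ≠ w`
  have htv : localComponent n K v t = 1 := localComponent_heckeElement_of_ne hwv.symm i
  have hgw : localComponent n K w (ofLocal n K v g) = 1 := localComponent_ofLocal_of_ne hwv g
  have hct : Commute t (ofLocal n K v g) := (mul_ofLocal_comm htv g)
  -- elements with trivial `w`-component commute with `t`
  have hcomm_t : ∀ x : FiniteAdelicGL n K, localComponent n K w x = 1 → x * t = t * x := fun x hx => by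
    rw [htdef, heckeElement_eq_ofLocal]
    exact mul_ofLocal_comm hx _
  -- the `w`-part of an element of `U` lies in every level and commutes with `ι_v(g)`
  have hpart : ∀ {l : FiniteAdelicGL n K}, l ∈ 𝒰.subgroup → ∀ s,
      ofLocal n K w (localComponent n K w l) ∈ 𝒰.tower s := fun hl s =>
    ofLocal_localComponent_mem_tower hw hl s
  have hpart_comm : ∀ l : FiniteAdelicGL n K,
      Commute (ofLocal n K w (localComponent n K w l)) (ofLocal n K v g) := fun l =>
    (mul_ofLocal_comm (localComponent_ofLocal_of_ne hwv.symm _) g)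
  refine ArithmeticQuotient.bijOn_doubleCosetQuot_conj h t hct (fun l hl => ?_) fun y hy hyc => ?_
  · -- (a) `l = l' · (t m t⁻¹)` with `l'` the `w`-part of `l`, `m = t⁻¹ (l'⁻¹ l) t = l'⁻¹ l`
    have hlU : l ∈ 𝒰.subgroup := 𝒰.tower_le r hl
    set l' := ofLocal n K w (localComponent n K w l) with hl'def
    have hm1 : localComponent n K w (l'⁻¹ * l) = 1 := by
      rw [map_mul, map_inv, hl'def, localComponent_ofLocal, inv_mul_cancel]
    have hconj : t⁻¹ * (l'⁻¹ * l) * t = l'⁻¹ * l := by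
      rw [mul_assoc, hcomm_t _ hm1, ← mul_assoc, inv_mul_cancel, one_mul]
    refine ⟨l', hpart hlU r', hpart_comm l, t⁻¹ * (l'⁻¹ * l) * t, ?_, ?_⟩
    · rw [hconj]
      exact mul_mem (inv_mem (hpart hlU r)) hl
    · group
  · -- (b) `t⁻¹ (ι_v(g)⁻¹ y ι_v(g)) t ∈ U_r` implies `t⁻¹ y t ∈ U_{r'}` for `y ∈ U_{r'}`
    have hyU : y ∈ 𝒰.subgroup := 𝒰.tower_le r' hy
    set y' := ofLocal n K w (localComponent n K w y) with hy'def
    set m := y'⁻¹ * y with hmdef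
    have hm1 : localComponent n K w m = 1 := by
      rw [hmdef, map_mul, map_inv, hy'def, localComponent_ofLocal, inv_mul_cancel]
    have hym : y = y' * m := by rw [hmdef, mul_inv_cancel_left]
    have hmr' : m ∈ 𝒰.tower r' := mul_mem (inv_mem (hpart hyU r')) hy
    -- `ι_v(g)⁻¹ m ι_v(g)` has trivial `w`-component, lies in `U_r`, and commutes with `t`
    have hgm : localComponent n K w ((ofLocal n K v g)⁻¹ * m * ofLocal n K v g) = 1 := by
      rw [map_mul, map_mul, map_inv, hgw, hm1, inv_one, one_mul, one_mul]
    have hgmr : (ofLocal n K v g)⁻¹ * m * ofLocal n K v g ∈ 𝒰.tower r := h _ hmr'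
    -- rewrite the hypothesis: `t⁻¹ (g⁻¹ y g) t = (t⁻¹ y' t) · (g⁻¹ m g)`
    have hy'g : (ofLocal n K v g)⁻¹ * y' * ofLocal n K v g = y' := by
      rw [mul_assoc, (hpart_comm y).eq, inv_mul_cancel_left]
    set z := (ofLocal n K v g)⁻¹ * m * ofLocal n K v g with hzdef
    have hzt : z * t = t * z := hcomm_t z hgm
    have hdec : t⁻¹ * ((ofLocal n K v g)⁻¹ * y * ofLocal n K v g) * t = t⁻¹ * y' * t * z := by
      have e1 : (ofLocal n K v g)⁻¹ * y * ofLocal n K v g = y' * z := by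
        calc (ofLocal n K v g)⁻¹ * y * ofLocal n K v g
            = (ofLocal n K v g)⁻¹ * y' * ofLocal n K v g *
                ((ofLocal n K v g)⁻¹ * m * ofLocal n K v g) := by rw [hym]; group
          _ = y' * z := by rw [hy'g]
      calc t⁻¹ * ((ofLocal n K v g)⁻¹ * y * ofLocal n K v g) * t
          = t⁻¹ * y' * (z * t) := by rw [e1]; group
        _ = t⁻¹ * y' * (t * z) := by rw [hzt]
        _ = t⁻¹ * y' * t * z := by group
    rw [hdec] at hyc
    have hy't : t⁻¹ * y' * t ∈ 𝒰.tower r := by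
      simpa only [mul_inv_cancel_right] using mul_mem hyc (inv_mem hgmr)
    -- `t⁻¹ y' t` is supported at `w`, hence lies in every level it lies in `U` for
    have hy't' : t⁻¹ * y' * t ∈ 𝒰.tower r' := by
      rw [mem_tower_iff] at hy't ⊢
      refine ⟨hy't.1, fun w' hw' => ?_⟩
      have hw'w : w' ≠ w := fun e => not_mem_asIdeal_of_not_mem_bad hw (e ▸ hw')
      rw [map_mul, map_mul, map_inv, localComponent_heckeElement_of_ne hw'w, hy'def,
        localComponent_ofLocal_of_ne hw'w, inv_one, one_mul, mul_one]
      exact one_mem _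
    -- conclude: `t⁻¹ y t = (t⁻¹ y' t) m`
    have hmt : m * t = t * m := hcomm_t m hm1
    have : t⁻¹ * y * t = t⁻¹ * y' * t * m := by
      calc t⁻¹ * y * t = t⁻¹ * y' * (m * t) := by rw [hym]; group
        _ = t⁻¹ * y' * (t * m) := by rw [hmt]
        _ = t⁻¹ * y' * t * m := by group
    rw [this]
    exact mul_mem hy't' hmr'

/-- `ι_v(g)`, `g ∈ GL_n(K_v)`, `v ∣ p`, is Hecke-compatible with `t_{w,i}` for every good place `w`.
[folklore] -/
theorem isHeckeCompatibleWith_ofLocal {v : IsDedekindDomain.HeightOneSpectrum (𝓞 K)}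
    (hv : (p : 𝓞 K) ∈ v.asIdeal) (g : GL (Fin n) (v.adicCompletion K))
    {w : IsDedekindDomain.HeightOneSpectrum (𝓞 K)} (hw : w ∉ 𝒰.bad) (i : ℕ) :
    IsHeckeCompatibleWith 𝒰.levelTower (heckeElement n K w i) (ofLocal n K v g) :=
  ⟨fun h => bijOn_tower_heckeElement_conj hv g hw i h, fun r => finite_orbit_quotient (𝒰.tower r) _⟩

variable (𝒰 k)

/-- **The `GL_n(K_v)`-action (`v ∣ p`) commutes with the Hecke operators `T_{w,i}` (`w ∉ S`) on
`H̃^j(K^p)_k`** [Emerton2006, §2.2, Thm. 2.2.16 (i)]. [cite: Emerton2006, §2.2, Thm. 2.2.16 (i)] -/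
theorem completedHeckeT_completedCohomologyLocalRep {v : IsDedekindDomain.HeightOneSpectrum (𝓞 K)}
    (hv : (p : 𝓞 K) ∈ v.asIdeal) {w : IsDedekindDomain.HeightOneSpectrum (𝓞 K)} (hw : w ∉ 𝒰.bad)
    (i j : ℕ) (g : GL (Fin n) (v.adicCompletion K))
    (x : CompletedCohomology k (globalEmbedding n K) 𝒰.levelTower (p : k) j) :
    𝒰.completedHeckeT k hw i j (𝒰.completedCohomologyLocalRep k hv j g x) =
      𝒰.completedCohomologyLocalRep k hv j g (𝒰.completedHeckeT k hw i j x) :=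
  completedHecke_rep (isTowerCompatible_heckeElement k hw i) (𝒰.toNormalizer hv g)
    (isHeckeCompatibleWith_ofLocal hv g hw i) j x

end TameLevel

end BigHeckeGLn

end Literature.NumberTheory.Automorphic
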